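import Summits.AtomisticToContinuum.Crystallization.Theorems.FrustratedLawDichotomyStrainedPatchRecutChart

/-!
# LEVEL TRANSPORT: the fit predicate and the fit level under a near-identity linear recut
# (27623 strained-patch piece, T-side [CORE-FAR]; decomp-a2c lens-5 «RecutPairs», generation 54, step (R6)/(R7) — critic row 1000 (A3))

**FILE SPLIT (gate 400-line cap, hand-2 g27 landing edit; statements and proofs byte-identical):** this file `…RecutLevelA` = PART A (§1–§3) of lens-5 g54's `…RecutLevel` 1d8b923dcd1a6691; PART B (§4–§5) is `…RecutLevel`, which imports this file and continues the SAME namespace `…Theorems.FrustratedLawDichotomyStrainedPatchRecutLevel` (all fully-qualified names unchanged).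

(Imports `…RecutChart`.)  Census KAPPA-N♭ (j346805) measured the transport of the fit level under the affine recut `z₀ ↦ (1+A)·z₀`:
`|η(z₁) − η(z₀)| ≈ L_N·‖A‖`, `L_N = 2.13 ≈ 2(1+η)` — the `d`-pinned fit scale doubles the naive constant.  This module PROVES that mechanism:

* §1 operator facts for `1 + A` (`‖(1+A)u‖ ≤ (1+α)‖u‖`, `‖(1+A)u − u‖ ≤ ‖A‖‖u‖`, an inverse `1 + A'` with `‖A'‖ ≤ α/(1−α)`);
* §2 `ShellGap g y i`: the annulus of radii `(13/10 ∓ g)·nn_i(y)` about the site carries no site (the QUANTITATIVE form of the clean-gap clause of `GoodAt`;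
  a chart-side column, instrumentable per family member);
* §3 ★ `fitAtScale_recut` — ONE pattern branch: if `y` fits the pattern at tolerance `< η₀` (scale `d = nn_i`, `d ≤ 3/2`), has shell gap `g ≥ 3α`, and the sites of
  `y'` within `3` of `y' i'` are exactly the `(1+A)`-images of the sites of `y` within `3` of `y i` (`‖A‖ ≤ α ≤ 1/20`), then `y'` fits the same pattern at
  tolerance `< (η₀ + (2+η₀)α)/(1−α)` with any cap `≥ (1+α)d`: new scale `d' = nn_{i'}(y') ∈ [(1−α)d, (1+α)d]`, same isometry, pattern sites transported, misfit
  `≤ α(1+η)d + ηd + αd`, clean gap `γ' = (g(1−α) − (13/5)α)·d > 0`; ★ `goodAtScale_recut` (both branches);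
* §4 ★ `fitLevel_recut_le`: `fitLevel y' i' ≤ (f + (2+f)α)/(1−α)`, `f = fitLevel y i` (through the infimum), and ★★ `abs_fitLevel_recut_le`: with shell gaps on
  both sides, `|fitLevel y' i' − fitLevel y i| ≤ (2 + 2·max f f')·α/(1 − 2α)` (the inverse recut `1 + A'`);
* §5 PINNED to the recut of `…RecutChart`: for `RecutOf A z₀ c₀ z₁ c₁ e₀ e₁` with the centre kept, the `3`-neighbourhoods correspond under `1+A` (`recutOf_local`,
  `recutOf_local'`), hence ★★ `goodAtScale_recutOf` ((R7)′: the recut centre is `((η₀ + (2+η₀)α)/(1−α))`-good) and ★★★ `levelNear_of_recutOf` ((R6)♯ PROVED modulo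
  the shell-gap columns: `‖A‖ ≤ κL₀·t`, `0 ≤ t ≤ 1/60`, gaps `g ≥ 4κL₀t` on chart and recut, chart centre `η₀₀ = 1/16`-good, `(1+α)·nn ≤ (3/2)(1−α)` ⇒
  `LevelNear κN♯ t z₀ c₀ z₁ c₁` with `κN♯ = kN2 = 9/10`: `(2 + 2·0.077)·(2/5)/(1 − 2/150) ≤ 9/10`).
No sorry, no new axioms, no cite tokens, no instances / notation.  `--supports stmt-AtomisticToContinuum-27623`.
-/

noncomputable section

namespace Summit.AtomisticToContinuum.Crystallization.Theorems.FrustratedLawDichotomyStrainedPatchRecutLevel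

open scoped BigOperators Classical
open Summit.AtomisticToContinuum.Crystallization.Theorems.FrustratedLawDichotomyPeriodicBlockFlags (goodAtScale_mono)
open Summit.AtomisticToContinuum.Crystallization.Theorems.FrustratedLawDichotomyRangeCut (Sep)
open Summit.AtomisticToContinuum.Crystallization.Theorems.FrustratedLawDichotomyMotifLemmas
open Summit.AtomisticToContinuum.Crystallization.Theorems.FrustratedLawDichotomyAveragingCut
open Summit.AtomisticToContinuum.Crystallization.Theorems.FrustratedLawDichotomyAveragingRuleCap
open Summit.AtomisticToContinuum.Crystallization.Theorems.FrustratedLawDichotomyAveragingRuleTightFree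
open Summit.AtomisticToContinuum.Crystallization.Theorems.FrustratedLawDichotomyExemptDoor (SitePred)
open Summit.AtomisticToContinuum.Crystallization.Theorems.FrustratedLawDichotomyExemptAbsorption
open Summit.AtomisticToContinuum.Crystallization.Theorems.FrustratedLawDichotomyExemptAbsorptionRecord
open Summit.AtomisticToContinuum.Crystallization.Theorems.FrustratedLawDichotomyCollarCensus
open Summit.AtomisticToContinuum.Crystallization.Theorems.FrustratedLawDichotomyCollarCensusKappa
open Summit.AtomisticToContinuum.Crystallization.Theorems.FrustratedLawDichotomyStrainedPatchHomSplit
open Summit.AtomisticToContinuum.Crystallization.Theorems.FrustratedLawDichotomyStrainedPatchCleanCollar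
open Summit.AtomisticToContinuum.Crystallization.Theorems.FrustratedLawDichotomyStrainedPatchHomTube
open Summit.AtomisticToContinuum.Crystallization.Theorems.FrustratedLawDichotomyStrainedPatchHomIsometry
open Summit.AtomisticToContinuum.Crystallization.Theorems.FrustratedLawDichotomyStrainedPatchHomTubeIso
open Summit.AtomisticToContinuum.Crystallization.Theorems.FrustratedLawDichotomyStrainedPatchPhaseCut
open Summit.AtomisticToContinuum.Crystallization.Theorems.FrustratedLawDichotomyStrainedPatchCoreTube
open Summit.AtomisticToContinuum.Crystallization.Theorems.FrustratedLawDichotomyStrainedPatchCoreTubeRecord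
open Summit.AtomisticToContinuum.Crystallization.Theorems.FrustratedLawDichotomyStrainedPatchCoreTubeMilli
open Summit.AtomisticToContinuum.Crystallization.Theorems.FrustratedLawDichotomyStrainedPatchStrainBands
open Summit.AtomisticToContinuum.Crystallization.Theorems.FrustratedLawDichotomyStrainedPatchChartFamilies
open Summit.AtomisticToContinuum.Crystallization.Theorems.FrustratedLawDichotomyStrainedPatchChartFamiliesBent
open Summit.AtomisticToContinuum.Crystallization.Theorems.FrustratedLawDichotomyStrainedPatchChartFamiliesPinned
open Summit.AtomisticToContinuum.Crystallization.Theorems.FrustratedLawDichotomyStrainedPatchEnvelopeLaw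
open Summit.AtomisticToContinuum.Crystallization.Theorems.FrustratedLawDichotomyStrainedPatchEnvelopeTaylor
open Literature.Barriers.AtomisticToContinuum.FlatleyTheil2015 (fccVec)
open Summit.AtomisticToContinuum.Crystallization.Theorems.FrustratedLawDichotomyStrainedPatchRecutPairs
open Summit.AtomisticToContinuum.Crystallization.Theorems.FrustratedLawDichotomyStrainedPatchRecutKinematics
open Literature.Barriers.AtomisticToContinuum.FlatleyTheil2015 (fccPoint)
open Summit.AtomisticToContinuum.Crystallization.Theorems.FrustratedLawDichotomyStrainedPatchHomRelief (latPt_fccVec_eq)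
open Summit.AtomisticToContinuum.Crystallization.Theorems.FrustratedLawDichotomyStrainedPatchHomLatticeBox (norm_apply_ge_of_near_one latPt_zero
  mem_box_of_norm_fccPoint_lt)
open Summit.AtomisticToContinuum.Crystallization.Theorems.FrustratedLawDichotomyStrainedPatchHomLatticeBoxHcp (latPt_eq_apply_one shifted_eq_apply)
open Summit.AtomisticToContinuum.Crystallization.Theorems.FrustratedLawDichotomyStrainedPatchHomLatticeBoxWindow (mem_box_of_norm_hexPt_lt'
  mem_box_of_norm_hexPt_add_shift_lt')
open Summit.AtomisticToContinuum.Crystallization.Theorems.FrustratedLawDichotomyStrainedPatchWindowFamilies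
open Summit.AtomisticToContinuum.Crystallization.Theorems.FrustratedLawDichotomyStrainedPatchRecutBuild
open Summit.AtomisticToContinuum.Crystallization.Theorems.FrustratedLawDichotomyStrainedPatchRecutRecord
open Summit.AtomisticToContinuum.Crystallization.Theorems.FrustratedLawDichotomyStrainedPatchRecutChart
open Literature.Geometry.DiscreteGeometry (nearestDist nearestDist_le_dist le_nearestDist exists_nearestDist_eq_dist nearestDist_nonneg
  fccKissingPattern hcpKissingPattern card_fccKissingPattern card_hcpKissingPattern norm_eq_one_of_mem_fccKissingPattern norm_eq_one_of_mem_hcpKissingPattern)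

/-! ## §1. Operator facts for `1 + A` -/

/-- `‖(1+A)u‖ ≤ (1+α)‖u‖`. [formal bookkeeping] -/
theorem norm_one_add_apply_le (A : E3 →L[ℝ] E3) {α : ℝ} (hA : ‖A‖ ≤ α) (u : E3) : ‖((1 : E3 →L[ℝ] E3) + A) u‖ ≤ (1 + α) * ‖u‖ :=
  (ContinuousLinearMap.le_opNorm _ _).trans (mul_le_mul_of_nonneg_right (norm_one_add_le A hA) (norm_nonneg _))

/-- `‖(1+A)u − u‖ ≤ ‖A‖·‖u‖`. [formal bookkeeping] -/
theorem norm_one_add_apply_sub_le (A : E3 →L[ℝ] E3) (u : E3) : ‖((1 : E3 →L[ℝ] E3) + A) u - u‖ ≤ ‖A‖ * ‖u‖ := by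
  have h : ((1 : E3 →L[ℝ] E3) + A) u = u + A u := by simp only [add_apply, one_apply_eq_self]
  rw [h, add_sub_cancel_left]; exact A.le_opNorm u

/-- `(1+A)u ≠ 0` for `u ≠ 0` and `‖A‖ ≤ α < 1`. [formal bookkeeping] -/
theorem one_add_apply_ne_zero (A : E3 →L[ℝ] E3) {α : ℝ} (hA : ‖A‖ ≤ α) (hα : α < 1) {u : E3} (hu : u ≠ 0) : ((1 : E3 →L[ℝ] E3) + A) u ≠ 0 := by
  intro h
  have h1 := antilipschitz_one_add A hA u
  rw [h, norm_zero] at h1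
  have : 0 < ‖u‖ := norm_pos_iff.2 hu
  nlinarith

/-- ★ The inverse of `1 + A` in the form `1 + A'` with `‖A'‖ ≤ α/(1−α)` (`‖A‖ ≤ α < 1`). [folklore] -/
theorem exists_inv_one_add (A : E3 →L[ℝ] E3) {α : ℝ} (hA : ‖A‖ ≤ α) (hα : α < 1) :
    ∃ A' : E3 →L[ℝ] E3, ‖A'‖ ≤ α / (1 - α) ∧ (∀ u, ((1 : E3 →L[ℝ] E3) + A') (((1 : E3 →L[ℝ] E3) + A) u) = u) ∧
      ∀ w, ((1 : E3 →L[ℝ] E3) + A) (((1 : E3 →L[ℝ] E3) + A') w) = w := by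
  obtain ⟨B, hB1, hB2, hBn⟩ := exists_inverse_one_add A hA hα
  have hpos : 0 < 1 - α := by linarith
  have hα0 : 0 ≤ α := (norm_nonneg A).trans hA
  have hBeq : ∀ w, ((1 : E3 →L[ℝ] E3) + (B - 1)) w = B w := fun w => by
    simp only [add_sub_cancel]
  refine ⟨B - 1, ?_, fun u => by rw [hBeq]; exact hB1 u, fun w => by rw [hBeq]; exact hB2 w⟩
  refine ContinuousLinearMap.opNorm_le_bound _ (div_nonneg hα0 hpos.le) fun u => ?_
  have hu : (B - 1) u = -(B (A u)) := by
    have h1 := hB1 u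
    simp only [add_apply, one_apply_eq_self, map_add] at h1
    simp only [sub_apply, one_apply_eq_self]
    rw [sub_eq_iff_eq_add, neg_add_eq_sub, eq_sub_iff_add_eq, h1]
  rw [hu, norm_neg]
  calc ‖B (A u)‖ ≤ ‖B‖ * ‖A u‖ := B.le_opNorm _
    _ ≤ (1 - α)⁻¹ * (α * ‖u‖) := mul_le_mul hBn ((A.le_opNorm u).trans (mul_le_mul_of_nonneg_right hA (norm_nonneg _)))
        (norm_nonneg _) (inv_nonneg.2 hpos.le)
    _ = α / (1 - α) * ‖u‖ := by rw [div_eq_inv_mul]; ring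

/-! ## §2. The shell gap -/

/-- **`ShellGap g y i`** [GEOMETRIC column] — no site of `y` lies in the open annulus of radii `(13/10 − g)·nn_i` and `(13/10 + g)·nn_i` about `y i`
(`nn_i = nearestDist y i`): the quantitative clean gap at `13/10·d` that the fit predicate `GoodAt` only asserts to be positive. -/
def ShellGap (g : ℝ) {N : ℕ} (y : Fin N → E3) (i : Fin N) : Prop :=
  ∀ k, k ≠ i → dist (y k) (y i) ≤ (13 / 10 - g) * nearestDist y i ∨ (13 / 10 + g) * nearestDist y i ≤ dist (y k) (y i)

/-- The shell gap is monotone: a wider empty annulus contains a narrower one. [formal bookkeeping] -/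
theorem ShellGap.mono {g g' : ℝ} (h : g' ≤ g) {N : ℕ} {y : Fin N → E3} {i : Fin N} (hg : ShellGap g y i) : ShellGap g' y i := by
  intro k hk
  have hnn := nearestDist_nonneg y i
  rcases hg k hk with h1 | h1
  · exact Or.inl (h1.trans (by nlinarith))
  · exact Or.inr (le_trans (by nlinarith) h1)

/-! ## §3. ★ Transport of one pattern branch of the fit predicate -/

/-- The coefficient inequalities behind the transported clean gap `γ' = (g(1−α) − (13/5)α)·d`. [formal bookkeeping] -/
theorem gap_coeff {α g : ℝ} (hα0 : 0 ≤ α) (hα : α ≤ 1 / 20) (hg : 3 * α ≤ g) (hg0 : 0 < g) :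
    0 < g * (1 - α) - 13 / 5 * α ∧ (1 + α) * (13 / 10 - g) + (g * (1 - α) - 13 / 5 * α) ≤ 13 / 10 * (1 - α) ∧
      13 / 10 * (1 + α) + (g * (1 - α) - 13 / 5 * α) ≤ (1 - α) * (13 / 10 + g) := by
  refine ⟨by nlinarith, by nlinarith, by nlinarith⟩

/-- ★ **ONE PATTERN BRANCH TRANSPORTS UNDER A NEAR-IDENTITY LINEAR RECUT.**  `P` a pattern of unit vectors (`u₀` any index), `y` injective fitting `P` at
`y i` with tolerance `< η₀ ≤ 1` and fit scale `d = nn_i(y) ≤ 3/2`, shell gap `g ∈ [3α, 1/10]`; `y'` injective whose sites within `3` of `y' i'` are exactly the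
`(1+A)`-images (based at `y' i'`) of the sites of `y` within `3` of `y i`, `‖A‖ ≤ α ≤ 1/20`.  Then `y'` fits `P` at `y' i'` with tolerance
`< (η₀ + (2+η₀)α)/(1−α)` and any cap `D' ≥ (1+α)d`. [folklore] -/
theorem fitAtScale_recut {ι : Type*} {P : ι → E3} (hP : ∀ u, ‖P u‖ = 1) (u₀ : ι) {N N' : ℕ} {y : Fin N → E3} {i : Fin N}
    {y' : Fin N' → E3} {i' : Fin N'} (hy : Function.Injective y) (hy' : Function.Injective y') (A : E3 →L[ℝ] E3) {α g : ℝ}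
    (hA : ‖A‖ ≤ α) (hα : α ≤ 1 / 20) (hg : 3 * α ≤ g) (hg0 : 0 < g) (hg1 : g ≤ 1 / 10)
    (H1 : ∀ k', dist (y' k') (y' i') ≤ 3 → ∃ k, y' k' - y' i' = ((1 : E3 →L[ℝ] E3) + A) (y k - y i))
    (H2 : ∀ k, dist (y k) (y i) ≤ 3 → ∃ k', y' k' - y' i' = ((1 : E3 →L[ℝ] E3) + A) (y k - y i))
    (HG : ShellGap g y i) (hd : nearestDist y i ≤ 3 / 2) {η₀ D D' : ℝ} (hη₀ : η₀ ≤ 1) (hD' : (1 + α) * nearestDist y i ≤ D')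
    (h : FitAtScale P η₀ D y i) : FitAtScale P ((η₀ + (2 + η₀) * α) / (1 - α)) D' y' i' := by
  obtain ⟨d, η, γ, Ai, -, t, hd0, hγ, hη, hfit, hpin, hpin', hgap⟩ := h
  have hα0 : 0 ≤ α := (norm_nonneg A).trans hA
  have h1α : 0 < 1 - α := by linarith
  have hdn : d = nearestDist y i := scale_eq_nearestDist hy hpin hpin'
  have HG' : ∀ k, k ≠ i → dist (y k) (y i) ≤ (13 / 10 - g) * d ∨ (13 / 10 + g) * d ≤ dist (y k) (y i) := by rw [hdn]; exact HG
  rw [← hdn] at hd hD'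
  -- operator bounds
  have hup : ∀ v : E3, ‖((1 : E3 →L[ℝ] E3) + A) v‖ ≤ (1 + α) * ‖v‖ := norm_one_add_apply_le A hA
  have hlo : ∀ v : E3, (1 - α) * ‖v‖ ≤ ‖((1 : E3 →L[ℝ] E3) + A) v‖ := antilipschitz_one_add A hA
  have hsub : ∀ v : E3, ‖((1 : E3 →L[ℝ] E3) + A) v - v‖ ≤ α * ‖v‖ := fun v =>
    (norm_one_add_apply_sub_le A v).trans (mul_le_mul_of_nonneg_right hA (norm_nonneg _))
  -- distances at `y'` are norms of images
  have hdist' : ∀ {k' : Fin N'} {k : Fin N}, y' k' - y' i' = ((1 : E3 →L[ℝ] E3) + A) (y k - y i) →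
      dist (y' k') (y' i') = ‖((1 : E3 →L[ℝ] E3) + A) (y k - y i)‖ := fun h => by rw [dist_eq_norm, h]
  -- images of distinct sites are distinct from the centre
  have hne' : ∀ {k' : Fin N'} {k : Fin N}, y' k' - y' i' = ((1 : E3 →L[ℝ] E3) + A) (y k - y i) → k ≠ i → k' ≠ i' := by
    intro k' k h hk hk'
    rw [hk', sub_self] at h
    exact one_add_apply_ne_zero A hA (by linarith) (sub_ne_zero.2 fun e => hk (hy e)) h.symm
  have hne : ∀ {k' : Fin N'} {k : Fin N}, y' k' - y' i' = ((1 : E3 →L[ℝ] E3) + A) (y k - y i) → k' ≠ i' → k ≠ i := by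
    intro k' k h hk' hk
    rw [hk, sub_self, map_zero, sub_eq_zero] at h
    exact hk' (hy' h)
  -- η ≥ 0 (from the fit of `u₀`) and the size of the pattern sites
  have hη0 : 0 ≤ η := by
    have := (norm_nonneg _).trans (hfit u₀).2
    nlinarith
  have htu : ∀ u, ‖t u - y i‖ ≤ (1 + η) * d := fun u => by
    have h1 := (hfit u).2
    have h2 : ‖d • Ai (P u)‖ = d := by rw [norm_smul, Ai.norm_map, hP, mul_one, Real.norm_of_nonneg hd0.le]
    calc ‖t u - y i‖ = ‖(t u - y i - d • Ai (P u)) + d • Ai (P u)‖ := by rw [sub_add_cancel]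
      _ ≤ ‖t u - y i - d • Ai (P u)‖ + ‖d • Ai (P u)‖ := norm_add_le _ _
      _ ≤ η * d + d := add_le_add h1 h2.le
      _ = (1 + η) * d := by ring
  -- a nearest site `k₀` of `y` and its image `k₀'`
  obtain ⟨s₀, ⟨k₀, rfl⟩, hk₀i, hk₀d⟩ := hpin'
  have hk₀ : k₀ ≠ i := fun e => hk₀i (congrArg y e)
  have hk₀d' : dist (y k₀) (y i) = d := le_antisymm hk₀d (hpin _ ⟨k₀, rfl⟩ hk₀i)
  obtain ⟨k₀', hk₀'⟩ := H2 k₀ (by rw [hk₀d']; linarith)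
  have hk₀'i : k₀' ≠ i' := hne' hk₀' hk₀
  -- the new scale `d'`
  have hd'up : nearestDist y' i' ≤ (1 + α) * d := by
    have h1 := nearestDist_le_dist y' hk₀'i
    rw [dist_comm, hdist' hk₀', ] at h1
    refine h1.trans ((hup _).trans ?_)
    rw [← dist_eq_norm, hk₀d']
  have hd'lo : (1 - α) * d ≤ nearestDist y' i' := by
    refine le_nearestDist ⟨k₀', hk₀'i⟩ fun k' hk' => ?_
    rw [dist_comm]
    by_cases h3 : dist (y' k') (y' i') ≤ 3
    · obtain ⟨k, hk⟩ := H1 k' h3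
      have hki : k ≠ i := hne hk hk'
      rw [hdist' hk]
      refine le_trans ?_ (hlo _)
      have := hpin (y k) ⟨k, rfl⟩ (fun e => hki (hy e))
      rw [dist_eq_norm] at this
      exact mul_le_mul_of_nonneg_left this h1α.le
    · push Not at h3
      nlinarith
  have hd'0 : 0 < nearestDist y' i' := lt_of_lt_of_le (by nlinarith) hd'lo
  -- the transported clean gap
  obtain ⟨hγ'0, hcA, hcB⟩ := gap_coeff hα0 hα hg hg0
  refine ⟨nearestDist y' i', (η + (2 + η) * α) / (1 - α), (g * (1 - α) - 13 / 5 * α) * d, Ai, hd'up.trans hD',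
    fun u => y' i' + ((1 : E3 →L[ℝ] E3) + A) (t u - y i), hd'0, mul_pos hγ'0 hd0, ?_, fun u => ⟨?_, ?_⟩, ?_, ?_, ?_⟩
  · -- tolerance
    exact div_lt_div_of_pos_right (by nlinarith) h1α
  · -- pattern sites are sites
    obtain ⟨k, hk⟩ := (hfit u).1
    obtain ⟨k', hk'⟩ := H2 k (by rw [dist_eq_norm, hk]; nlinarith [htu u])
    exact ⟨k', show y' k' = y' i' + ((1 : E3 →L[ℝ] E3) + A) (t u - y i) by rw [← hk, ← hk', add_sub_cancel]⟩
  · -- misfit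
    have hv := htu u
    have h1 := (hfit u).2
    have hw : ‖Ai (P u)‖ = 1 := by rw [Ai.norm_map, hP]
    have hdd : |d - nearestDist y' i'| ≤ α * d := abs_sub_le_iff.2 ⟨by linarith, by linarith⟩
    have hX : 0 ≤ η + (2 + η) * α := by positivity
    calc ‖y' i' + ((1 : E3 →L[ℝ] E3) + A) (t u - y i) - y' i' - nearestDist y' i' • Ai (P u)‖
        = ‖(((1 : E3 →L[ℝ] E3) + A) (t u - y i) - (t u - y i)) + (t u - y i - d • Ai (P u)) + (d - nearestDist y' i') • Ai (P u)‖ := by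
          congr 1; rw [sub_smul]; abel
      _ ≤ ‖((1 : E3 →L[ℝ] E3) + A) (t u - y i) - (t u - y i)‖ + ‖t u - y i - d • Ai (P u)‖ + ‖(d - nearestDist y' i') • Ai (P u)‖ :=
          norm_add₃_le
      _ ≤ α * ((1 + η) * d) + η * d + α * d := by
          refine add_le_add (add_le_add ((hsub _).trans (mul_le_mul_of_nonneg_left hv hα0)) h1) ?_
          rw [norm_smul, hw, mul_one, Real.norm_eq_abs]; exact hdd
      _ = (η + (2 + η) * α) * d := by ring
      _ = (η + (2 + η) * α) / (1 - α) * ((1 - α) * d) := by field_simp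
      _ ≤ (η + (2 + η) * α) / (1 - α) * nearestDist y' i' := mul_le_mul_of_nonneg_left hd'lo (div_nonneg hX h1α.le)
  · -- pinning below
    rintro s ⟨k', rfl⟩ hsi
    have hk' : k' ≠ i' := fun e => hsi (congrArg y' e)
    rw [dist_comm]; exact nearestDist_le_dist y' hk'
  · -- pinning attained
    obtain ⟨k₁, hk₁, hk₁d⟩ := exists_nearestDist_eq_dist y' ⟨k₀', hk₀'i⟩
    exact ⟨y' k₁, ⟨k₁, rfl⟩, fun e => hk₁ (hy' e), by rw [dist_comm, hk₁d]⟩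
  · -- clean gap
    rintro s ⟨k', rfl⟩ hsi hlt
    have hk' : k' ≠ i' := fun e => hsi (congrArg y' e)
    have h3 : dist (y' k') (y' i') ≤ 3 := by nlinarith
    obtain ⟨k, hk⟩ := H1 k' h3
    have hki : k ≠ i := hne hk hk'
    rw [hdist' hk] at hlt ⊢
    rcases HG' k hki with hA1 | hB1
    · -- inner shell: transported inside, and a pattern site
      refine ⟨?_, ?_⟩
      · calc ‖((1 : E3 →L[ℝ] E3) + A) (y k - y i)‖ ≤ (1 + α) * ‖y k - y i‖ := hup _
          _ ≤ (1 + α) * ((13 / 10 - g) * d) := by rw [← dist_eq_norm]; exact mul_le_mul_of_nonneg_left hA1 (by linarith)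
          _ ≤ 13 / 10 * ((1 - α) * d) - (g * (1 - α) - 13 / 5 * α) * d := by nlinarith
          _ ≤ 13 / 10 * nearestDist y' i' - (g * (1 - α) - 13 / 5 * α) * d := by nlinarith
      · have hlt₀ : dist (y k) (y i) < 13 / 10 * d + γ := by nlinarith
        obtain ⟨-, ⟨u, hu⟩⟩ := hgap (y k) ⟨k, rfl⟩ (fun e => hki (hy e)) hlt₀
        exact ⟨u, show y' i' + ((1 : E3 →L[ℝ] E3) + A) (t u - y i) = y' k' by rw [hu, ← hk, add_sub_cancel]⟩
    · -- outer shell: transported outside the window — impossible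
      exfalso
      have h1 : (1 - α) * ((13 / 10 + g) * d) ≤ ‖((1 : E3 →L[ℝ] E3) + A) (y k - y i)‖ := by
        refine le_trans (mul_le_mul_of_nonneg_left ?_ h1α.le) (hlo _)
        rwa [← dist_eq_norm]
      nlinarith

/-- Unpacking: a good site has another site. [formal bookkeeping] -/
theorem exists_ne_of_goodAtScale {η D : ℝ} {N : ℕ} {y : Fin N → E3} {i : Fin N} (h : GoodAtScale η D y i) : ∃ k, k ≠ i := by
  obtain ⟨d, η', γ, Ai, -, hor⟩ := h
  rcases hor with ⟨t, -, -, -, -, -, ⟨s, ⟨k, rfl⟩, hsi, -⟩, -⟩ | ⟨t, -, -, -, -, -, ⟨s, ⟨k, rfl⟩, hsi, -⟩, -⟩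
  · exact ⟨k, fun e => hsi (congrArg y e)⟩
  · exact ⟨k, fun e => hsi (congrArg y e)⟩

/-- The recut's nearest-neighbour distance is at most `(1+α)·nn_i(y)` (image of a nearest site). [folklore] -/
theorem nearestDist_recut_le {N N' : ℕ} {y : Fin N → E3} {i : Fin N} {y' : Fin N' → E3} {i' : Fin N'} (hy : Function.Injective y)
    (A : E3 →L[ℝ] E3) {α : ℝ} (hA : ‖A‖ ≤ α) (hα : α < 1)
    (H2 : ∀ k, dist (y k) (y i) ≤ 3 → ∃ k', y' k' - y' i' = ((1 : E3 →L[ℝ] E3) + A) (y k - y i))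
    (hex : ∃ k, k ≠ i) (hd3 : nearestDist y i ≤ 3) : nearestDist y' i' ≤ (1 + α) * nearestDist y i := by
  obtain ⟨k₀, hk₀, hk₀d⟩ := exists_nearestDist_eq_dist y hex
  obtain ⟨k₀', hk₀'⟩ := H2 k₀ (by rw [dist_comm, ← hk₀d]; exact hd3)
  have hk₀'i : k₀' ≠ i' := by
    intro e; rw [e, sub_self] at hk₀'
    exact one_add_apply_ne_zero A hA hα (sub_ne_zero.2 fun h => hk₀ (hy h)) hk₀'.symm
  calc nearestDist y' i' ≤ dist (y' i') (y' k₀') := nearestDist_le_dist y' hk₀'i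
    _ = ‖((1 : E3 →L[ℝ] E3) + A) (y k₀ - y i)‖ := by rw [dist_comm, dist_eq_norm, hk₀']
    _ ≤ (1 + α) * ‖y k₀ - y i‖ := norm_one_add_apply_le A hA _
    _ = (1 + α) * nearestDist y i := by rw [← dist_eq_norm, dist_comm, ← hk₀d]

/-- … and at least `(1−α)·nn_i(y)` (every near site of the recut is an image; far ones are farther than `3 ≥ nn_i`). [folklore] -/
theorem le_nearestDist_recut {N N' : ℕ} {y : Fin N → E3} {i : Fin N} {y' : Fin N' → E3} {i' : Fin N'} (hy : Function.Injective y)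
    (hy' : Function.Injective y') (A : E3 →L[ℝ] E3) {α : ℝ} (hA : ‖A‖ ≤ α) (hα : α < 1)
    (H1 : ∀ k', dist (y' k') (y' i') ≤ 3 → ∃ k, y' k' - y' i' = ((1 : E3 →L[ℝ] E3) + A) (y k - y i))
    (H2 : ∀ k, dist (y k) (y i) ≤ 3 → ∃ k', y' k' - y' i' = ((1 : E3 →L[ℝ] E3) + A) (y k - y i))
    (hex : ∃ k, k ≠ i) (hd3 : nearestDist y i ≤ 3) : (1 - α) * nearestDist y i ≤ nearestDist y' i' := by
  have hα0 : 0 ≤ α := (norm_nonneg A).trans hA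
  have hnn := nearestDist_nonneg y i
  obtain ⟨k₀, hk₀, hk₀d⟩ := exists_nearestDist_eq_dist y hex
  obtain ⟨k₀', hk₀'⟩ := H2 k₀ (by rw [dist_comm, ← hk₀d]; exact hd3)
  have hk₀'i : k₀' ≠ i' := by
    intro e; rw [e, sub_self] at hk₀'
    exact one_add_apply_ne_zero A hA hα (sub_ne_zero.2 fun h => hk₀ (hy h)) hk₀'.symm
  refine le_nearestDist ⟨k₀', hk₀'i⟩ fun k' hk' => ?_
  by_cases h3 : dist (y' k') (y' i') ≤ 3
  · obtain ⟨k, hk⟩ := H1 k' h3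
    have hki : k ≠ i := by
      intro e; rw [e, sub_self, map_zero, sub_eq_zero] at hk
      exact hk' (hy' hk)
    calc (1 - α) * nearestDist y i ≤ (1 - α) * ‖y k - y i‖ := by
          refine mul_le_mul_of_nonneg_left ?_ (by linarith)
          rw [← dist_eq_norm, dist_comm]; exact nearestDist_le_dist y hki
      _ ≤ ‖((1 : E3 →L[ℝ] E3) + A) (y k - y i)‖ := antilipschitz_one_add A hA _
      _ = dist (y' i') (y' k') := by rw [dist_comm, dist_eq_norm, hk]
  · push Not at h3
    rw [dist_comm] at h3
    nlinarith

/-- ★ **THE FIT PREDICATE TRANSPORTS** (both pattern branches of `GoodAtScale`). [folklore] -/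
theorem goodAtScale_recut {N N' : ℕ} {y : Fin N → E3} {i : Fin N} {y' : Fin N' → E3} {i' : Fin N'} (hy : Function.Injective y)
    (hy' : Function.Injective y') (A : E3 →L[ℝ] E3) {α g : ℝ} (hA : ‖A‖ ≤ α) (hα : α ≤ 1 / 20) (hg : 3 * α ≤ g) (hg0 : 0 < g) (hg1 : g ≤ 1 / 10)
    (H1 : ∀ k', dist (y' k') (y' i') ≤ 3 → ∃ k, y' k' - y' i' = ((1 : E3 →L[ℝ] E3) + A) (y k - y i))
    (H2 : ∀ k, dist (y k) (y i) ≤ 3 → ∃ k', y' k' - y' i' = ((1 : E3 →L[ℝ] E3) + A) (y k - y i))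
    (HG : ShellGap g y i) (hd : nearestDist y i ≤ 3 / 2) {η₀ D D' : ℝ} (hη₀ : η₀ ≤ 1) (hD' : (1 + α) * nearestDist y i ≤ D')
    (h : GoodAtScale η₀ D y i) : GoodAtScale ((η₀ + (2 + η₀) * α) / (1 - α)) D' y' i' := by
  obtain ⟨uf, huf⟩ := Finset.card_pos.mp (show 0 < fccKissingPattern.card by rw [card_fccKissingPattern]; norm_num)
  obtain ⟨uh, huh⟩ := Finset.card_pos.mp (show 0 < hcpKissingPattern.card by rw [card_hcpKissingPattern]; norm_num)
  rw [goodAtScale_iff_fcc_or_hcp] at h ⊢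
  rcases h with h | h
  · exact Or.inl (fitAtScale_recut (fun u => norm_eq_one_of_mem_fccKissingPattern u.2) ⟨uf, huf⟩ hy hy' A hA hα hg hg0 hg1 H1 H2 HG hd
      hη₀ hD' h)
  · exact Or.inr (fitAtScale_recut (fun u => norm_eq_one_of_mem_hcpKissingPattern u.2) ⟨uh, huh⟩ hy hy' A hA hα hg hg0 hg1 H1 H2 HG hd
      hη₀ hD' h)

end Summit.AtomisticToContinuum.Crystallization.Theorems.FrustratedLawDichotomyStrainedPatchRecutLevel
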